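import Mathlib.Data.List.Basic
import Mathlib.Data.List.InsertIdx
import Mathlib.Tactic

/-!
# `Lines/toric_sgame_mixedloop.lean` — hypotheses (G1) and (G2) of the termination theorem are NEEDED: infinite legal plays on a
mixed-pattern chain, at a deep residual branch, and at an all-infinite curve, in the kernel (res-B-lens-2 g10; rev 3 = rev 2 + §I)

Crux `stmt-ResolutionOfSingularities-0549` (`Theses.Descent.DescentPerfectToAll`), sub-line `giraud-weak-normal-form`.
LABELS: bears_on LADDER-RESOLUTION:B · [OURS · CANDIDATE] counted 0 · de-risking scaffolding for the Giraud-normal-form sub-line,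
NOT rung-B progress · nothing here proves resolution in char p · resolution in char p NOT proved · AI-written, weaker than expert
review · PURE COMBINATORICS about the b-graded toric S-GAME of loop note `giraud-weak-normal-form-RFINE-loop.md` §9 / sheet
`giraud-double-cubic-Tpp-sheet.md` §2 (a MODEL of the S-visible part of a resolution engine on ONE local normal form), NOT any statement
about schemes. A crux WORKFILE, not a skeleton: no `sorry`, registers no stub, never to be `ledger skeleton check`ed against 0549/0550.

WHAT THIS FILE SETTLES (rev 3 = rev 2 + §I; rev 2 = rev 1 + §H; §B/§G of rev 1 and §H of rev 2 unchanged). The termination theorem `Lines/toric_sgame_termination.lean`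
(rev 2: `no_infinite_play`, `no_infinite_play_u`, `legalPlays_bounded(_u)`) carries the hypotheses (G1) «all curves of the chain have
the SAME non-empty set of finite grades» and (G2) «residual branches are not deep» (together `Good` / `GoodU`). Its header asserted that
both are NEEDED — (G1) on the strength of a python simulation (`cas/potcheck.py`), (G2) by the remark that a deep residual branch is never
accepted. Here both necessities are KERNEL THEOREMS. (G1): the two-curve ALL-BOUNDARY chain `V(0,5,5) — V(∞,1,1)` (both curves non-deep, `w₃ = 0`; the patterns of finite grades
DIFFER: `{0,1,2}` versus `{1,2}`) admits an INFINITE LEGAL PLAY under EVERY rule set `topj` — so it satisfies every hypothesis of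
`no_infinite_play` except (G1) (all curves boundary ⇒ `ModeOK topj` for every `topj`, (G2) vacuous; `no_infinite_play_u` is about chains
with a residual branch FIRST and is bounded by §H instead — crit-1 A-17 wording nit), and the conclusion fails:

* `mixedPattern_infinitePlay topj : IsInfinitePlay topj [V(0,5,5), V(∞,1,1)] mv` — the play `mv` = `I 0, D 1, D 1` and then the period
  `P 0, D 1, I 0, D 1, D 1` for ever is legal at every step;
* `unbounded_legalPlays topj N : ∃ l, isLegalPlay topj [V(0,5,5), V(∞,1,1)] l = true ∧ N < l.length` (contrast `legalPlays_bounded`);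
* `exists_infinitePlay_without_G1` — the packaged statement `∃ ch, (∀ c ∈ ch, c.bd = true ∧ isDeepW c.w = false) ∧ ∃ f, ∀ topj,
  IsInfinitePlay topj ch f ∧ ∀ N, ∃ l, isLegalPlay topj ch l = true ∧ N < l.length`.

(G2), §H: `residualDeep_infinitePlay topj : IsInfinitePlay topj [R, V(0,0,0)] mv2` for the residual branch `R = (9,9,9)` (`bd = false`,
DEEP) — all six grades finite, one common pattern, so (G1) holds, `ModeOK topj` for `topj ≥ 2` and the `GoodU` shape (residual first,
the rest boundary) for `topj ≤ 1`; only (G2) fails — with the play `mv2` = `P 0, D 1, D 1` for ever: `R` has kind `resid` (never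
accepted, not «deep» for the deep-first rule, unhandled), the T-point `R ∩ V(0,3k,6k)` is an isolated TOP Sing₂ point, `P 0` (exponent 3)
creates `(6, 3k+7, 6k+8)`, two `D 1` settle it to `V(0,3k+3,6k+6)`: period 3, the boundary tail grows by one curve per period
(`stateR_period`); `unbounded_legalPlays_R`, packaged `exists_infinitePlay_without_G2`. In the engine this is the case `R ⊂ Sing_top`
(the residual branch itself lies in the top locus), handled by the curve move on `R`'s own stratum OUTSIDE the S-game — the model's
infinite play is the correct transcription of «the S-game alone never finishes there».

NON-EMPTINESS, §I: the clause «the common set of finite grades is NON-EMPTY» of (G1) is needed as well — `allInfinite_infinitePlay topj t :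
IsInfinitePlay topj (V(∞,∞,∞) :: t) (fun _ => D 0)`: a curve with all three grades infinite (all class parts `g_b ≡ 0`) is «deep», deep-first
accepts it, and the accept changes nothing (`∞ − θ_b = ∞`), for ever; packaged `exists_infinitePlay_emptyPattern`. (In the engine `g ≡ 0`
means `f = z³/3 + y³/3` up to the unit: the whole curve germ is equimultiple and the engine blows up the CURVE — outside the point game.)

THE MECHANISM of §G (why mixed patterns loop). After `k` periods the state is `s0 k = V(0,5,5) :: X k :: T k` with `X k = V(∞,0,5k+3)` (outside
class 𝒞, so the node `V(0,5,5) ∩ X k` is an isolated Sing₂ point with both branches unhandled — and it is TOP: `o = (∞, 5, 5k+8)`), and a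
dead tail `T k` of light / class-less curves. `P 0` (exponent 3) creates the deep curve `N1 k = V(∞,3,5k+7)`; `D 1` settles it to the light
curve `Y k = V(∞,1,5k+6)` whose point next to `V(0,5,5)` is a JUMP point; `I 0` creates `N2 k = V(∞,4,5k+10)`, two `D 1` settle it to
`X (k+1) = V(∞,0,5k+8)` — the state `s0 (k+1)`. The grade-0 weight of every newborn is `∞` (inherited from `V(∞,1,1)`), so the newborn
never enters class 𝒞 through `w₀` and the node at `V(0,5,5)` is re-created with `w₂` five larger each period: no potential that is
monotone under the moves can exist. With a COMMON pattern this cannot happen (termination file, `Mp_child`: the subtractive-Euclid pair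
measure drops at every top blow-up) — (G1) is exactly what the example violates. In the engine (G1) is automatic: `w_b = ∞` means the
class part `g_b` of `f` vanishes identically, a property of `f` shared by every curve of one game; the example is a statement about the
MODEL's hypotheses, recorded so that the termination theorem is not misread as unconditional in the weights.

RELATION TO THE OTHER WORKFILES. §B (copy) re-declares the MODEL CORE of `Lines/toric_sgame.lean` §B VERBATIM (namespace
`….ToricSGame.MixedLoop`, nothing clashes; crux workfiles are not importable modules); `playState` / `IsInfinitePlay` / `playState_shift`
are copied from the termination file §T5 and five arithmetic one-liners from `Lines/toric_sgame_allchains.lean` §B′. §G/§H are new: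
INTRODUCTION lemmas for `legalMoves` (`D1_legal`: deep-first accepts curve 1 when curve 0 is not deep; `P0_legal`: an isolated Sing₂ point
with unhandled branches and no deep curve; `I0_legal`: a jump point on a light curve, no deep curve — every `topj`), the five period steps
`step0 … step4` and their legality `legal0 … legal4`, the opening `open0 … open2`, `state_period` (induction on the period count) and the
theorems; §H likewise (`P0_legal'` with the weaker hypothesis «no curve of KIND deep», states `u0/u1/u2`, steps `stepR0–2`, `legalR0–2`,
`stateR_period`). Plain tactic proofs (`simp` / `omega` / `decide` on closed instances / `interval_cases`), no `sorry`, standard axioms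
only (`#print axioms` = `propext, Classical.choice, Quot.sound` for all four packaged theorems), `maxHeartbeats 1600000` as in the
sibling files.

## Contents
* §B (copy) model core.
* §G the mixed-pattern loop: intro lemmas for `legalMoves`, the chain `[cb, ca]`, the curves `X k, Y k, N1 k, N2 k, N3 k`, the tail `T k`,
  the states `s0 … s4`, the play `mv`, `state_period`, `mixedPattern_infinitePlay`, `pref` / `isLegalPlay_pref` / `unbounded_legalPlays`,
  `exists_infinitePlay_without_G1`.
* §H the deep-residual loop: `deepFilter_nil'`, `P0_legal'`, `R9`, `z k`, `M1 k`, `M2 k`, `ZT k`, `u0 … u2`, `mv2`, `stateR_period`,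
  `residualDeep_infinitePlay`, `unbounded_legalPlays_R`, `exists_infinitePlay_without_G2`.
* §I the empty-pattern loop: `D0_legal`, `cinf = V(∞,∞,∞)`, `allInfinite_infinitePlay`, `exists_infinitePlay_emptyPattern`.

-/

set_option linter.unusedVariables false
set_option linter.unusedSectionVars false
set_option linter.style.longLine false
set_option linter.style.longFile 0
set_option maxHeartbeats 1600000
set_option linter.unusedSimpArgs false
set_option linter.dupNamespace false

namespace Summit.ResolutionOfSingularities.ResolutionOfSingularities.Cruxes.DescentPerfectToAll.ToricSGame.MixedLoop

/-! ## §B (copy). The b-graded toric S-game — model core, VERBATIM from `Lines/toric_sgame.lean` §B (= `Lines/toric_sgame_allchains.lean` §B copy). -/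

/-- One grade weight `w_b = ord_C(g_b)`; `none` = ∞ (the class part `g_b` is identically zero). -/
abbrev Wt := Option ℕ

/-- `w ≥ t` for a grade weight (`∞ ≥ t` always). -/
def wge (w : Wt) (t : ℕ) : Bool := match w with | none => true | some n => Nat.ble t n

/-- `1 ≤ c < ∞`. -/
def finPos (c : Wt) : Bool := match c with | none => false | some n => Nat.ble 1 n

/-- Sum of grade weights (∞ absorbing). -/
def wadd : Wt → Wt → Wt
  | some x, some y => some (x + y)
  | _, _ => none

/-- The weight vector `(w₀, w₁, w₂)` of a curve (orders of the three class parts `g₀, g₁, g₂`). -/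
structure W3 where
  w0 : Wt
  w1 : Wt
  w2 : Wt
deriving DecidableEq, Repr, Inhabited, Hashable

namespace W3
/-- componentwise `w ≥ (t₀,t₁,t₂)` -/
def ge (w : W3) (t0 t1 t2 : ℕ) : Bool := wge w.w0 t0 && wge w.w1 t1 && wge w.w2 t2
/-- node order `o = w' + w''` -/
def add (a b : W3) : W3 := ⟨wadd a.w0 b.w0, wadd a.w1 b.w1, wadd a.w2 b.w2⟩
/-- accept: `w ↦ w − (d₀,d₁,d₂)` -/
def sub (w : W3) (d0 d1 d2 : ℕ) : W3 := ⟨w.w0.map (· - d0), w.w1.map (· - d1), w.w2.map (· - d2)⟩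
end W3

/-- thresholds: `θ = (3,2,1)` (TOP / DEEP), `(2,2,1)` (Sing₂), `(2,1,0)` (class 𝒞). -/
def isDeepW (w : W3) : Bool := w.ge 3 2 1
def isSingW (w : W3) : Bool := w.ge 2 2 1
def isCW (w : W3) : Bool := w.ge 2 1 0

/-- A curve of the chain: class weights `w`, the CUBIC weight `w3 = ord_C` of the class-3 part `(z³+y³)/3` (θ₃ = 3; it never
influences legality — bookkeeping for the (OFF-S) census of §9.12/9.14), and the flag `bd` (`true` = boundary/exceptional curve, a legal
centre; `false` = the residual transversal branch `R` of mode `u`, never a centre; its weights are the residual exponents `c`). -/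
structure Curve where
  w : W3
  w3 : ℕ
  bd : Bool
deriving DecidableEq, Repr, Inhabited, Hashable

/-- The state: the chain of curves `K₀ — K₁ — ⋯ — K_n`; point `i` is the node between `K_i` and `K_{i+1}`. -/
abbrev Chain := List Curve

/-- Moves: `D k` accept the deep curve `k` (α = 3); `A k` / `AL k` accept the borderline / relevant light curve `k` (α = 2);
`I i` blow up the jump (or, under `G_mult`, top) point `i` of a handled curve (α = 3); `P i` blow up the isolated Sing₂ point `i`
(α = 3 if top, else 2). -/
inductive Move
  | D (k : ℕ) | A (k : ℕ) | AL (k : ℕ) | I (i : ℕ) | P (i : ℕ)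
deriving DecidableEq, Repr

inductive Kind | resid | deep | borderline | light | none
deriving DecidableEq, Repr

def kindOf (c : Curve) : Kind :=
  if !c.bd then .resid else if isDeepW c.w then .deep else if isSingW c.w then .borderline
  else if isCW c.w then .light else .none

/-- the two branches at point `i` -/
def nodeAt (ch : Chain) (i : ℕ) : Option (Curve × Curve) :=
  match ch[i]?, ch[i+1]? with
  | some a, some b => some (a, b)
  | _, _ => none

/-- residual exponents at a T-point (`none` at a 𝒟-node) -/
def resid (a b : Curve) : Option W3 := if !a.bd then some a.w else if !b.bd then some b.w else none

/-- `x ∈ Sing₂` (multiplicity / ν dictionary 9.3′, T-point rule rev 2: `c₀ ≥ 1 ⇒ o₀ ≥ 3`, `c₁ ≥ 1 ⇒ o₁ ≥ 2`, `c₂ ≥ 1 ⇒ o₂ ≥ 1`). -/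
def sing2N (a b : Curve) : Bool :=
  let o := a.w.add b.w
  isSingW o &&
  (match resid a b with
   | none => true
   | some c => (!finPos c.w0 || wge o.w0 3) && (!finPos c.w1 || wge o.w1 2) && (!finPos c.w2 || wge o.w2 1))

/-- `x` TOP (multiplicity 3): Sing₂ and `o ≥ θ`. -/
def topN (a b : Curve) : Bool := sing2N a b && isDeepW (a.w.add b.w)

/-- `x` a JUMP point of a (non-deep, class-𝒞) curve through it: top, and at a T-point `c_b ≥ 1 ⇒ o_b ≥ 4 − b`. -/
def jumpN (a b : Curve) : Bool :=
  let o := a.w.add b.w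
  topN a b &&
  (match resid a b with
   | none => true
   | some c => (!finPos c.w0 || wge o.w0 4) && (!finPos c.w1 || wge o.w1 3) && (!finPos c.w2 || wge o.w2 2))

def sing2At (ch : Chain) (i : ℕ) : Bool := match nodeAt ch i with | some (a, b) => sing2N a b | none => false
def topAt (ch : Chain) (i : ℕ) : Bool := match nodeAt ch i with | some (a, b) => topN a b | none => false
def jumpAt (ch : Chain) (i : ℕ) : Bool := match nodeAt ch i with | some (a, b) => jumpN a b | none => false
def kindAt (ch : Chain) (k : ℕ) : Kind := match ch[k]? with | some c => kindOf c | none => .none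

/-- the points (node indices) of curve `k` in a chain of length `n` -/
def ptsOf (n k : ℕ) : List ℕ := (if 1 ≤ k then [k - 1] else []) ++ (if k + 1 < n then [k] else [])

/-- a light curve is RELEVANT iff one of its points is in Sing₂ -/
def relevantLight (ch : Chain) (k : ℕ) : Bool := kindAt ch k == .light && (ptsOf ch.length k).any (sing2At ch)

/-- curves that HANDLE their points (curves first at points): deep, borderline, relevant light -/
def handled (ch : Chain) (k : ℕ) : Bool :=
  kindAt ch k == .deep || kindAt ch k == .borderline || relevantLight ch k

/-- The LEGAL MOVES under STRICT legality (deep-first; curves first at points), variant `topj`: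
`topj = 0` = loop-note rev 2; `topj = 1` = rev 3 (top points on relevant light curves are blown up first);
`topj = 2` = `G_mult` (top points on borderline curves too). The list is the SET of legal moves (any order = rule `free`). -/
def legalMoves (topj : ℕ) (ch : Chain) : List Move :=
  let n := ch.length
  let idx := List.range n
  match idx.filter (fun k => kindAt ch k == .deep) with
  | k :: _ => [Move.D k]
  | [] =>
    let curveMoves := idx.flatMap (fun k =>
      match kindAt ch k with
      | .borderline =>
          let js := (ptsOf n k).filter (fun i => jumpAt ch i || (Nat.ble 2 topj && topAt ch i))
          if js.isEmpty then [Move.A k] else js.map Move.I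
      | .light =>
          if (ptsOf n k).any (sing2At ch) then
            let js := (ptsOf n k).filter (fun i => jumpAt ch i || (Nat.ble 1 topj && topAt ch i))
            if js.isEmpty then [Move.AL k] else js.map Move.I
          else []
      | _ => [])
    let pMoves := ((List.range (n - 1)).filter
      (fun i => sing2At ch i && !handled ch i && !handled ch (i + 1))).map Move.P
    curveMoves ++ pMoves

/-- LOOSE legality (for contrast only; = `coupled_sim3`'s `free2`): isolated point blow-ups are also allowed at points of
relevant light curves. It admits an infinite legal play (§C). -/
def looseMoves (topj : ℕ) (ch : Chain) : List Move :=
  let n := ch.length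
  legalMoves topj ch ++ ((List.range (n - 1)).filter
      (fun i => sing2At ch i && relevantLight ch i || sing2At ch i && relevantLight ch (i + 1))).map Move.P

/-- TERMINAL: no deep/borderline curve and no Sing₂ point. -/
def terminalB (ch : Chain) : Bool :=
  (List.range ch.length).all (fun k => kindAt ch k != .deep && kindAt ch k != .borderline) &&
  (List.range (ch.length - 1)).all (fun i => !sing2At ch i)

/-- blow up point `i` with exponent `α`: newborn curve with `w_b = o_b + b − α`, inserted between the two branches. -/
def blowup (ch : Chain) (i α : ℕ) : Chain :=
  match nodeAt ch i with
  | none => ch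
  | some (a, b) =>
    let o := a.w.add b.w
    ch.insertIdx (i + 1) ⟨⟨o.w0.map (· - α), o.w1.map (· + 1 - α), o.w2.map (· + 2 - α)⟩, a.w3 + b.w3 + 3 - α, true⟩

/-- play one move -/
def applyMove (ch : Chain) : Move → Chain
  | .D k => ch.modify k (fun c => { c with w := c.w.sub 3 2 1 })
  | .A k => ch.modify k (fun c => { c with w := c.w.sub 2 1 0, w3 := c.w3 + 1 })
  | .AL k => ch.modify k (fun c => { c with w := c.w.sub 2 1 0, w3 := c.w3 + 1 })
  | .I i => blowup ch i 3
  | .P i => blowup ch i (if topAt ch i then 3 else 2)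

/-- play a list of moves -/
def applyMoves (ch : Chain) (l : List Move) : Chain := l.foldl applyMove ch

/-- is `l` a legal play from `ch` (every move legal when played)? -/
def isLegalPlay (topj : ℕ) : Chain → List Move → Bool
  | _, [] => true
  | ch, m :: l => (legalMoves topj ch).contains m && isLegalPlay topj (applyMove ch m) l



/-! ## §G. Hypothesis (G1) is needed: an infinite legal play on the mixed-pattern chain `V(0,5,5) — V(∞,1,1)` (mode uv). -/

/-- the state after playing `f 0, …, f (n-1)` from `ch` (copy of `Lines/toric_sgame_termination.lean` §T5) -/
def playState (ch : Chain) (f : ℕ → Move) : ℕ → Chain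
  | 0 => ch
  | n + 1 => applyMove (playState ch f n) (f n)

/-- `f` is an INFINITE LEGAL PLAY from `ch`: every move is legal when played (copy of §T5) -/
def IsInfinitePlay (topj : ℕ) (ch : Chain) (f : ℕ → Move) : Prop := ∀ n, f n ∈ legalMoves topj (playState ch f n)


/-! ### arithmetic one-liners (copies of `Lines/toric_sgame_allchains.lean` §B′) -/
theorem wge_some (n t : ℕ) : wge (some n) t = decide (t ≤ n) := by
  simp only [wge]
  rw [Bool.eq_iff_iff, Nat.ble_eq, decide_eq_true_eq]
theorem wge_none (t : ℕ) : wge none t = true := rfl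
theorem wadd_some (x y : ℕ) : wadd (some x) (some y) = some (x + y) := rfl
theorem wadd_none_l (y : Wt) : wadd none y = none := by cases y <;> rfl
theorem wadd_none_r (x : Wt) : wadd x none = none := by cases x <;> rfl

/-! ### three ways to be a legal move (introduction lemmas for `legalMoves`) -/

theorem kindAt_cons_zero (c : Curve) (t : Chain) : kindAt (c :: t) 0 = kindOf c := by unfold kindAt; simp
theorem kindAt_cons_succ (c : Curve) (t : Chain) (k : ℕ) : kindAt (c :: t) (k + 1) = kindAt t k := by unfold kindAt; simp
theorem nodeAt_zero (c d : Curve) (t : Chain) : nodeAt (c :: d :: t) 0 = some (c, d) := by unfold nodeAt; simp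
theorem sing2At_zero (c d : Curve) (t : Chain) : sing2At (c :: d :: t) 0 = sing2N c d := by unfold sing2At; rw [nodeAt_zero]
theorem topAt_zero (c d : Curve) (t : Chain) : topAt (c :: d :: t) 0 = topN c d := by unfold topAt; rw [nodeAt_zero]
theorem jumpAt_zero (c d : Curve) (t : Chain) : jumpAt (c :: d :: t) 0 = jumpN c d := by unfold jumpAt; rw [nodeAt_zero]

theorem kindOf_deep_isDeep {c : Curve} (h : kindOf c = .deep) : isDeepW c.w = true := by
  unfold kindOf at h
  cases hb : c.bd <;> cases hd : isDeepW c.w <;> cases hs : isSingW c.w <;> cases hcw : isCW c.w <;> simp [hb, hd, hs, hcw] at h ⊢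

/-- no deep curve ⇒ the deep-first filter is empty -/
theorem deepFilter_nil (ch : Chain) (hnd : ∀ x ∈ ch, isDeepW x.w = false) :
    (List.range ch.length).filter (fun k => kindAt ch k == .deep) = [] := by
  rw [List.filter_eq_nil_iff]
  intro k hk
  have hk' : k < ch.length := List.mem_range.mp hk
  unfold kindAt
  rw [List.getElem?_eq_getElem hk']
  simp only
  intro h
  have h' : kindOf ch[k] = .deep := by simpa using h
  have := kindOf_deep_isDeep h'
  rw [hnd _ (List.getElem_mem hk')] at this
  exact Bool.false_ne_true this

theorem range_two_cons (n : ℕ) : List.range (n + 2) = 0 :: 1 :: (List.range n).map (· + 2) := by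
  rw [List.range_succ_eq_map, List.range_succ_eq_map, List.map_cons, List.map_map]
  rfl

/-- `D 1` is legal as soon as curve 1 is deep and curve 0 is not (deep-first takes the first deep curve) -/
theorem D1_legal (topj : ℕ) (c d : Curve) (t : Chain) (hc : kindOf c ≠ .deep) (hd : kindOf d = .deep) :
    Move.D 1 ∈ legalMoves topj (c :: d :: t) := by
  unfold legalMoves
  have hlen : (c :: d :: t).length = t.length + 2 := by simp
  simp only [hlen, range_two_cons, List.filter_cons, kindAt_cons_zero, kindAt_cons_succ, hd]
  have h0 : (kindOf c == Kind.deep) = false := by simpa using hc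
  simp [h0]

/-- an isolated Sing₂ point `0` with both branches unhandled and no deep curve: `P 0` is legal -/
theorem P0_legal (topj : ℕ) (c d : Curve) (t : Chain) (hnd : ∀ x ∈ c :: d :: t, isDeepW x.w = false)
    (hs : sing2N c d = true) (h0 : handled (c :: d :: t) 0 = false) (h1 : handled (c :: d :: t) 1 = false) :
    Move.P 0 ∈ legalMoves topj (c :: d :: t) := by
  unfold legalMoves
  simp only [deepFilter_nil _ hnd]
  simp only [List.mem_append, List.mem_map, List.mem_filter, List.mem_range]
  right
  refine ⟨0, ⟨by simp, ?_⟩, rfl⟩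
  simp [sing2At_zero, hs, h0, h1]

/-- a jump point `0` on the light curve `1`, no deep curve: `I 0` is legal (every rule set) -/
theorem I0_legal (topj : ℕ) (c d : Curve) (t : Chain) (hnd : ∀ x ∈ c :: d :: t, isDeepW x.w = false)
    (hl : kindOf d = .light) (hs : sing2N c d = true) (hj : jumpN c d = true) :
    Move.I 0 ∈ legalMoves topj (c :: d :: t) := by
  unfold legalMoves
  simp only [deepFilter_nil _ hnd]
  simp only [List.mem_append, List.mem_flatMap, List.mem_range]
  left
  refine ⟨1, by simp, ?_⟩
  simp only [kindAt_cons_succ, kindAt_cons_zero, hl]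
  have hpt : 0 ∈ ptsOf (c :: d :: t).length 1 := by unfold ptsOf; simp
  have hany : (ptsOf (c :: d :: t).length 1).any (sing2At (c :: d :: t)) = true :=
    List.any_eq_true.mpr ⟨0, hpt, by rw [sing2At_zero]; exact hs⟩
  rw [if_pos hany]
  have hmem : 0 ∈ (ptsOf (c :: d :: t).length 1).filter (fun i => jumpAt (c :: d :: t) i || (Nat.ble 1 topj && topAt (c :: d :: t) i)) := by
    rw [List.mem_filter]; exact ⟨hpt, by rw [jumpAt_zero, hj]; rfl⟩
  have hne : ((ptsOf (c :: d :: t).length 1).filter (fun i => jumpAt (c :: d :: t) i || (Nat.ble 1 topj && topAt (c :: d :: t) i))).isEmpty = false := by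
    cases hf : (ptsOf (c :: d :: t).length 1).filter (fun i => jumpAt (c :: d :: t) i || (Nat.ble 1 topj && topAt (c :: d :: t) i)) with
    | nil => rw [hf] at hmem; simp at hmem
    | cons _ _ => rfl
  simp only [hne]
  exact List.mem_map.mpr ⟨0, hmem, rfl⟩

/-! ### the chain, the play, the states -/

def cb : Curve := ⟨⟨some 0, some 5, some 5⟩, 0, true⟩
def ca : Curve := ⟨⟨none, some 1, some 1⟩, 0, true⟩
def X (k : ℕ) : Curve := ⟨⟨none, some 0, some (5 * k + 3)⟩, 0, true⟩
def Y (k : ℕ) : Curve := ⟨⟨none, some 1, some (5 * k + 6)⟩, 0, true⟩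
def N1 (k : ℕ) : Curve := ⟨⟨none, some 3, some (5 * k + 7)⟩, 0, true⟩
def N2 (k : ℕ) : Curve := ⟨⟨none, some 4, some (5 * k + 10)⟩, 0, true⟩
def N3 (k : ℕ) : Curve := ⟨⟨none, some 2, some (5 * k + 9)⟩, 0, true⟩
/-- the dead tail after `k` periods -/
def T : ℕ → Chain
  | 0 => [ca]
  | k + 1 => Y k :: X k :: T k
def s0 (k : ℕ) : Chain := cb :: X k :: T k
def s1 (k : ℕ) : Chain := cb :: N1 k :: X k :: T k
def s2 (k : ℕ) : Chain := cb :: Y k :: X k :: T k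
def s3 (k : ℕ) : Chain := cb :: N2 k :: Y k :: X k :: T k
def s4 (k : ℕ) : Chain := cb :: N3 k :: Y k :: X k :: T k

/-- the periodic play: `I 0, D 1, D 1`, then for ever `P 0, D 1, I 0, D 1, D 1` -/
def mv (n : ℕ) : Move :=
  if n = 0 then .I 0 else if n = 1 then .D 1 else if n = 2 then .D 1 else
  match (n - 3) % 5 with
  | 0 => .P 0
  | 2 => .I 0
  | _ => .D 1

/-! ### weight facts (all `k`) -/

theorem T_facts (k : ℕ) : ∀ x ∈ T k, x.bd = true ∧ isDeepW x.w = false := by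
  induction k with
  | zero => intro x hx; simp [T] at hx; subst hx; decide
  | succ k ih =>
    intro x hx
    simp only [T, List.mem_cons] at hx
    rcases hx with rfl | rfl | hx
    · exact ⟨rfl, by simp [Y, isDeepW, W3.ge, wge, Nat.ble]⟩
    · exact ⟨rfl, by simp [X, isDeepW, W3.ge, wge, Nat.ble]⟩
    · exact ih x hx

theorem X_notDeep (k : ℕ) : isDeepW (X k).w = false := by simp [X, isDeepW, W3.ge, wge, Nat.ble]
theorem Y_notDeep (k : ℕ) : isDeepW (Y k).w = false := by simp [Y, isDeepW, W3.ge, wge, Nat.ble]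
theorem cb_notDeep : isDeepW cb.w = false := by decide
theorem kind_cb : kindOf cb = .none := by decide
theorem kind_X (k : ℕ) : kindOf (X k) = .none := by
  simp [kindOf, X, isDeepW, isSingW, isCW, W3.ge, wge, Nat.ble]
theorem kind_Y (k : ℕ) : kindOf (Y k) = .light := by
  simp [kindOf, Y, isDeepW, isSingW, isCW, W3.ge, wge_some, wge_none]
theorem kind_N1 (k : ℕ) : kindOf (N1 k) = .deep := by
  simp [kindOf, N1, isDeepW, W3.ge, wge_some, wge_none]
theorem kind_N2 (k : ℕ) : kindOf (N2 k) = .deep := by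
  simp [kindOf, N2, isDeepW, W3.ge, wge_some, wge_none]
theorem kind_N3 (k : ℕ) : kindOf (N3 k) = .deep := by
  simp [kindOf, N3, isDeepW, W3.ge, wge_some, wge_none]
theorem kind_ca : kindOf ca = .light := by decide

theorem sing2_cb_X (k : ℕ) : sing2N cb (X k) = true := by
  simp [sing2N, resid, cb, X, isSingW, W3.ge, W3.add, wadd_some, wadd_none_l, wadd_none_r, wge_some, wge_none]
  omega
theorem top_cb_X (k : ℕ) : topN cb (X k) = true := by
  unfold topN; rw [sing2_cb_X]
  simp [cb, X, isDeepW, W3.ge, W3.add, wadd_some, wadd_none_l, wadd_none_r, wge_some, wge_none]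
  omega
theorem sing2_cb_Y (k : ℕ) : sing2N cb (Y k) = true := by
  simp [sing2N, resid, cb, Y, isSingW, W3.ge, W3.add, wadd_some, wadd_none_l, wadd_none_r, wge_some, wge_none]
  omega
theorem jump_cb_Y (k : ℕ) : jumpN cb (Y k) = true := by
  unfold jumpN topN; rw [sing2_cb_Y]
  simp [resid, cb, Y, isDeepW, W3.ge, W3.add, wadd_some, wadd_none_l, wadd_none_r, wge_some, wge_none]
  omega
theorem sing2_cb_ca : sing2N cb ca = true := by decide
theorem jump_cb_ca : jumpN cb ca = true := by decide

/-- curve 1 of `s0 k` is unhandled: `X k` is outside class 𝒞 -/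
theorem handled_s0_one (k : ℕ) : handled (s0 k) 1 = false := by
  unfold handled relevantLight s0; rw [kindAt_cons_succ, kindAt_cons_zero, kind_X]; simp
theorem handled_s0_zero (k : ℕ) : handled (s0 k) 0 = false := by
  unfold handled relevantLight s0; rw [kindAt_cons_zero, kind_cb]; simp

theorem notDeep_s0 (k : ℕ) : ∀ x ∈ s0 k, isDeepW x.w = false := by
  intro x hx; simp only [s0, List.mem_cons] at hx
  rcases hx with rfl | rfl | hx
  · exact cb_notDeep
  · exact X_notDeep k
  · exact (T_facts k x hx).2
theorem notDeep_s2 (k : ℕ) : ∀ x ∈ s2 k, isDeepW x.w = false := by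
  intro x hx; simp only [s2, List.mem_cons] at hx
  rcases hx with rfl | rfl | rfl | hx
  · exact cb_notDeep
  · exact Y_notDeep k
  · exact X_notDeep k
  · exact (T_facts k x hx).2

/-! ### the five steps of a period, and the three opening moves -/

theorem step0 (k : ℕ) : applyMove (s0 k) (.P 0) = s1 k := by
  simp only [s0, s1, applyMove, topAt_zero, top_cb_X, if_true]
  unfold blowup; rw [nodeAt_zero]
  simp [cb, X, N1, W3.add, wadd_some, wadd_none_l, wadd_none_r]
  omega
theorem step1 (k : ℕ) : applyMove (s1 k) (.D 1) = s2 k := by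
  unfold applyMove s1 s2; simp [N1, Y, W3.sub]
theorem step2 (k : ℕ) : applyMove (s2 k) (.I 0) = s3 k := by
  simp only [s2, s3, applyMove]
  unfold blowup; rw [nodeAt_zero]
  simp [cb, Y, N2, W3.add, wadd_some, wadd_none_l, wadd_none_r]
  omega
theorem step3 (k : ℕ) : applyMove (s3 k) (.D 1) = s4 k := by
  unfold applyMove s3 s4; simp [N2, N3, W3.sub]
theorem step4 (k : ℕ) : applyMove (s4 k) (.D 1) = s0 (k + 1) := by
  unfold applyMove s4 s0; simp [N3, X, T, W3.sub]; omega

theorem legal0 (topj k : ℕ) : Move.P 0 ∈ legalMoves topj (s0 k) :=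
  P0_legal topj cb (X k) (T k) (notDeep_s0 k) (sing2_cb_X k) (handled_s0_zero k) (handled_s0_one k)
theorem legal1 (topj k : ℕ) : Move.D 1 ∈ legalMoves topj (s1 k) :=
  D1_legal topj cb (N1 k) _ (by rw [kind_cb]; decide) (kind_N1 k)
theorem legal2 (topj k : ℕ) : Move.I 0 ∈ legalMoves topj (s2 k) :=
  I0_legal topj cb (Y k) _ (notDeep_s2 k) (kind_Y k) (sing2_cb_Y k) (jump_cb_Y k)
theorem legal3 (topj k : ℕ) : Move.D 1 ∈ legalMoves topj (s3 k) :=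
  D1_legal topj cb (N2 k) _ (by rw [kind_cb]; decide) (kind_N2 k)
theorem legal4 (topj k : ℕ) : Move.D 1 ∈ legalMoves topj (s4 k) :=
  D1_legal topj cb (N3 k) _ (by rw [kind_cb]; decide) (kind_N3 k)

/-- opening: `[V(0,5,5), V(∞,1,1)]` ⟶ `I 0, D 1, D 1` ⟶ `s0 0` -/
def c1 : Chain := [cb, ⟨⟨none, some 4, some 5⟩, 0, true⟩, ca]
def c2 : Chain := [cb, ⟨⟨none, some 2, some 4⟩, 0, true⟩, ca]
theorem open0 : applyMove [cb, ca] (.I 0) = c1 := by decide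
theorem open1 : applyMove c1 (.D 1) = c2 := by decide
theorem open2 : applyMove c2 (.D 1) = s0 0 := by decide
theorem legalOpen0 (topj : ℕ) : Move.I 0 ∈ legalMoves topj [cb, ca] :=
  I0_legal topj cb ca [] (by decide) kind_ca sing2_cb_ca jump_cb_ca
theorem legalOpen1 (topj : ℕ) : Move.D 1 ∈ legalMoves topj c1 := D1_legal topj cb _ _ (by rw [kind_cb]; decide) (by decide)
theorem legalOpen2 (topj : ℕ) : Move.D 1 ∈ legalMoves topj c2 := D1_legal topj cb _ _ (by rw [kind_cb]; decide) (by decide)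

/-! ### the play is infinite and legal -/

theorem mv_period (k : ℕ) : mv (3 + 5 * k) = .P 0 ∧ mv (3 + 5 * k + 1) = .D 1 ∧ mv (3 + 5 * k + 2) = .I 0 ∧
    mv (3 + 5 * k + 3) = .D 1 ∧ mv (3 + 5 * k + 4) = .D 1 := by
  unfold mv
  refine ⟨?_, ?_, ?_, ?_, ?_⟩ <;> (rw [if_neg (by omega), if_neg (by omega), if_neg (by omega)]) <;>
    first
    | (have h : (3 + 5 * k - 3) % 5 = 0 := by omega); simp only [h]
    | (have h : (3 + 5 * k + 1 - 3) % 5 = 1 := by omega); simp only [h]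
    | (have h : (3 + 5 * k + 2 - 3) % 5 = 2 := by omega); simp only [h]
    | (have h : (3 + 5 * k + 3 - 3) % 5 = 3 := by omega); simp only [h]
    | (have h : (3 + 5 * k + 4 - 3) % 5 = 4 := by omega); simp only [h]

theorem state_period (k : ℕ) : playState [cb, ca] mv (3 + 5 * k) = s0 k ∧ playState [cb, ca] mv (3 + 5 * k + 1) = s1 k ∧
    playState [cb, ca] mv (3 + 5 * k + 2) = s2 k ∧ playState [cb, ca] mv (3 + 5 * k + 3) = s3 k ∧
    playState [cb, ca] mv (3 + 5 * k + 4) = s4 k := by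
  induction k with
  | zero =>
    have e0 : playState [cb, ca] mv 3 = s0 0 := by
      show applyMove (applyMove (applyMove [cb, ca] (mv 0)) (mv 1)) (mv 2) = s0 0
      rw [show mv 0 = .I 0 from rfl, show mv 1 = .D 1 from rfl, show mv 2 = .D 1 from rfl, open0, open1, open2]
    obtain ⟨m0, m1, m2, m3, m4⟩ := mv_period 0
    have e1 : playState [cb, ca] mv (3 + 5 * 0 + 1) = s1 0 := by
      show applyMove (playState [cb, ca] mv (3 + 5 * 0)) (mv (3 + 5 * 0)) = s1 0; rw [m0]; rw [show 3 + 5 * 0 = 3 from rfl, e0, step0]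
    have e2 : playState [cb, ca] mv (3 + 5 * 0 + 2) = s2 0 := by
      show applyMove (playState [cb, ca] mv (3 + 5 * 0 + 1)) (mv (3 + 5 * 0 + 1)) = s2 0; rw [m1, e1, step1]
    have e3 : playState [cb, ca] mv (3 + 5 * 0 + 3) = s3 0 := by
      show applyMove (playState [cb, ca] mv (3 + 5 * 0 + 2)) (mv (3 + 5 * 0 + 2)) = s3 0; rw [m2, e2, step2]
    have e4 : playState [cb, ca] mv (3 + 5 * 0 + 4) = s4 0 := by
      show applyMove (playState [cb, ca] mv (3 + 5 * 0 + 3)) (mv (3 + 5 * 0 + 3)) = s4 0; rw [m3, e3, step3]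
    exact ⟨e0, e1, e2, e3, e4⟩
  | succ k ih =>
    obtain ⟨_, _, _, _, e4⟩ := ih
    obtain ⟨_, _, _, _, m4⟩ := mv_period k
    obtain ⟨m0, m1, m2, m3, _⟩ := mv_period (k + 1)
    have e0 : playState [cb, ca] mv (3 + 5 * (k + 1)) = s0 (k + 1) := by
      rw [show 3 + 5 * (k + 1) = (3 + 5 * k + 4) + 1 by ring]
      show applyMove (playState [cb, ca] mv (3 + 5 * k + 4)) (mv (3 + 5 * k + 4)) = s0 (k + 1); rw [m4, e4, step4]
    have e1 : playState [cb, ca] mv (3 + 5 * (k + 1) + 1) = s1 (k + 1) := by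
      show applyMove (playState [cb, ca] mv (3 + 5 * (k + 1))) (mv (3 + 5 * (k + 1))) = s1 (k + 1); rw [m0, e0, step0]
    have e2 : playState [cb, ca] mv (3 + 5 * (k + 1) + 2) = s2 (k + 1) := by
      show applyMove (playState [cb, ca] mv (3 + 5 * (k + 1) + 1)) (mv (3 + 5 * (k + 1) + 1)) = s2 (k + 1); rw [m1, e1, step1]
    have e3 : playState [cb, ca] mv (3 + 5 * (k + 1) + 3) = s3 (k + 1) := by
      show applyMove (playState [cb, ca] mv (3 + 5 * (k + 1) + 2)) (mv (3 + 5 * (k + 1) + 2)) = s3 (k + 1); rw [m2, e2, step2]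
    have e4' : playState [cb, ca] mv (3 + 5 * (k + 1) + 4) = s4 (k + 1) := by
      show applyMove (playState [cb, ca] mv (3 + 5 * (k + 1) + 3)) (mv (3 + 5 * (k + 1) + 3)) = s4 (k + 1); rw [m3, e3, step3]
    exact ⟨e0, e1, e2, e3, e4'⟩

/-- THEOREM (hypothesis (G1) of `Lines/toric_sgame_termination.lean` is NEEDED). The two-curve boundary chain
`V(0,5,5) — V(∞,1,1)` — both curves non-deep, but with DIFFERENT sets of finite grades — admits an infinite legal play under every
rule set `topj`: the opening `I 0, D 1, D 1` followed by the period `P 0, D 1, I 0, D 1, D 1` for ever (the node next to `V(0,5,5)` is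
re-created as a top point after every period, with `w₂` growing by 5). -/
theorem mixedPattern_infinitePlay (topj : ℕ) : IsInfinitePlay topj [cb, ca] mv := by
  intro n
  rcases Nat.lt_or_ge n 3 with hn | hn
  · interval_cases n
    · exact legalOpen0 topj
    · show mv 1 ∈ legalMoves topj (applyMove [cb, ca] (mv 0)); rw [show mv 0 = .I 0 from rfl, open0]; exact legalOpen1 topj
    · show mv 2 ∈ legalMoves topj (applyMove (applyMove [cb, ca] (mv 0)) (mv 1))
      rw [show mv 0 = .I 0 from rfl, show mv 1 = .D 1 from rfl, open0, open1]; exact legalOpen2 topj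
  · obtain ⟨k, r, hr, rfl⟩ : ∃ k r, r < 5 ∧ n = 3 + 5 * k + r := ⟨(n - 3) / 5, (n - 3) % 5, Nat.mod_lt _ (by omega), by omega⟩
    obtain ⟨e0, e1, e2, e3, e4⟩ := state_period k
    obtain ⟨m0, m1, m2, m3, m4⟩ := mv_period k
    interval_cases r
    · rw [Nat.add_zero, m0, e0]; exact legal0 topj k
    · rw [m1, e1]; exact legal1 topj k
    · rw [m2, e2]; exact legal2 topj k
    · rw [m3, e3]; exact legal3 topj k
    · rw [m4, e4]; exact legal4 topj k

/-! ### every length is reached by a legal play (contrast: `legalPlays_bounded` of the termination file) -/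

/-- the first `n` moves of `f` -/
def pref (f : ℕ → Move) : ℕ → List Move
  | 0 => []
  | n + 1 => f 0 :: pref (fun k => f (k + 1)) n

theorem pref_length (f : ℕ → Move) (n : ℕ) : (pref f n).length = n := by
  induction n generalizing f with
  | zero => rfl
  | succ n ih => simp [pref, ih]

theorem playState_shift (ch : Chain) (f : ℕ → Move) (n : ℕ) :
    playState (applyMove ch (f 0)) (fun k => f (k + 1)) n = playState ch f (n + 1) := by
  induction n with
  | zero => rfl
  | succ n ih => simp only [playState, ih]

theorem IsInfinitePlay.shift {topj : ℕ} {ch : Chain} {f : ℕ → Move} (h : IsInfinitePlay topj ch f) :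
    IsInfinitePlay topj (applyMove ch (f 0)) (fun k => f (k + 1)) := by
  intro n; rw [playState_shift]; exact h (n + 1)

theorem isLegalPlay_pref {topj : ℕ} : ∀ (n : ℕ) (ch : Chain) (f : ℕ → Move), IsInfinitePlay topj ch f → isLegalPlay topj ch (pref f n) = true
  | 0, _, _, _ => rfl
  | n + 1, ch, f, h => by
    simp only [pref, isLegalPlay, Bool.and_eq_true]
    exact ⟨List.elem_eq_true_of_mem (h 0), isLegalPlay_pref n _ _ h.shift⟩

/-- legal plays of EVERY length from `V(0,5,5) — V(∞,1,1)`, under every rule set -/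
theorem unbounded_legalPlays (topj N : ℕ) : ∃ l : List Move, isLegalPlay topj [cb, ca] l = true ∧ N < l.length :=
  ⟨pref mv (N + 1), isLegalPlay_pref (N + 1) _ _ (mixedPattern_infinitePlay topj), by rw [pref_length]; omega⟩

/-- COROLLARY: without (G1) the termination theorem fails — there is an all-boundary chain of non-deep curves with an infinite legal play
under every rule set. -/
theorem exists_infinitePlay_without_G1 :
    ∃ ch : Chain, (∀ c ∈ ch, c.bd = true ∧ isDeepW c.w = false) ∧ ∃ f, ∀ topj, IsInfinitePlay topj ch f ∧
      ∀ N, ∃ l : List Move, isLegalPlay topj ch l = true ∧ N < l.length :=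
  ⟨[cb, ca], by intro c hc; simp at hc; rcases hc with rfl | rfl <;> decide, mv,
    fun topj => ⟨mixedPattern_infinitePlay topj, unbounded_legalPlays topj⟩⟩

/-! ## §H. Hypothesis (G2) is needed: a DEEP residual branch is never accepted and its T-point is blown up for ever (mode u). -/

/-- no curve OF KIND deep ⇒ the deep-first filter is empty (a deep RESIDUAL branch has kind `resid`, not `deep`) -/
theorem deepFilter_nil' (ch : Chain) (hnd : ∀ x ∈ ch, kindOf x ≠ .deep) :
    (List.range ch.length).filter (fun k => kindAt ch k == .deep) = [] := by
  rw [List.filter_eq_nil_iff]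
  intro k hk
  have hk' : k < ch.length := List.mem_range.mp hk
  unfold kindAt
  rw [List.getElem?_eq_getElem hk']
  simp only
  intro h
  have h' : kindOf ch[k] = .deep := by simpa using h
  exact hnd _ (List.getElem_mem hk') h'

/-- `P0_legal` with the weaker hypothesis «no curve of kind deep» -/
theorem P0_legal' (topj : ℕ) (c d : Curve) (t : Chain) (hnd : ∀ x ∈ c :: d :: t, kindOf x ≠ .deep)
    (hs : sing2N c d = true) (h0 : handled (c :: d :: t) 0 = false) (h1 : handled (c :: d :: t) 1 = false) :
    Move.P 0 ∈ legalMoves topj (c :: d :: t) := by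
  unfold legalMoves
  simp only [deepFilter_nil' _ hnd]
  simp only [List.mem_append, List.mem_map, List.mem_filter, List.mem_range]
  right
  refine ⟨0, ⟨by simp, ?_⟩, rfl⟩
  simp [sing2At_zero, hs, h0, h1]

/-- the deep residual branch `R = (9,9,9)` (`bd = false`) and the boundary curves `z k = V(0,3k,6k)` -/
def R9 : Curve := ⟨⟨some 9, some 9, some 9⟩, 0, false⟩
def z (k : ℕ) : Curve := ⟨⟨some 0, some (3 * k), some (6 * k)⟩, 0, true⟩
def M1 (k : ℕ) : Curve := ⟨⟨some 6, some (3 * k + 7), some (6 * k + 8)⟩, 0, true⟩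
def M2 (k : ℕ) : Curve := ⟨⟨some 3, some (3 * k + 5), some (6 * k + 7)⟩, 0, true⟩
/-- the boundary tail after `k` periods: `z k :: … :: z 0` -/
def ZT : ℕ → Chain
  | 0 => [z 0]
  | k + 1 => z (k + 1) :: ZT k
def u0 (k : ℕ) : Chain := R9 :: ZT k
def u1 (k : ℕ) : Chain := R9 :: M1 k :: ZT k
def u2 (k : ℕ) : Chain := R9 :: M2 k :: ZT k

/-- the periodic play `P 0, D 1, D 1` for ever -/
def mv2 (n : ℕ) : Move := match n % 3 with | 0 => .P 0 | _ => .D 1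

theorem ZT_cons (k : ℕ) : ∃ t, ZT k = z k :: t ∧ ∀ x ∈ t, ∃ j, x = z j := by
  cases k with
  | zero => exact ⟨[], rfl, by simp⟩
  | succ k =>
    refine ⟨ZT k, rfl, ?_⟩
    intro x hx
    induction k with
    | zero => simp [ZT] at hx; exact ⟨0, hx⟩
    | succ k ih => simp only [ZT, List.mem_cons] at hx; rcases hx with rfl | hx; exacts [⟨k + 1, rfl⟩, ih hx]

theorem kind_R9 : kindOf R9 = .resid := by decide
theorem kind_z (k : ℕ) : kindOf (z k) = .none := by
  simp [kindOf, z, isDeepW, isSingW, isCW, W3.ge, wge_some]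
theorem kind_M1 (k : ℕ) : kindOf (M1 k) = .deep := by
  simp [kindOf, M1, isDeepW, W3.ge, wge_some]
theorem kind_M2 (k : ℕ) : kindOf (M2 k) = .deep := by
  simp [kindOf, M2, isDeepW, W3.ge, wge_some]
theorem sing2_R9_z (k : ℕ) : sing2N R9 (z k) = true := by
  simp [sing2N, resid, R9, z, isSingW, W3.ge, W3.add, wadd_some, wge_some]; omega
theorem top_R9_z (k : ℕ) : topN R9 (z k) = true := by
  unfold topN; rw [sing2_R9_z]
  simp [R9, z, isDeepW, W3.ge, W3.add, wadd_some, wge_some]; omega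

theorem kinds_u0 (k : ℕ) : ∀ x ∈ u0 k, kindOf x ≠ .deep := by
  obtain ⟨t, ht, hz⟩ := ZT_cons k
  intro x hx
  simp only [u0, ht, List.mem_cons] at hx
  rcases hx with rfl | rfl | hx
  · rw [kind_R9]; decide
  · rw [kind_z]; decide
  · obtain ⟨j, rfl⟩ := hz x hx; rw [kind_z]; decide

theorem stepR0 (k : ℕ) : applyMove (u0 k) (.P 0) = u1 k := by
  obtain ⟨t, ht, _⟩ := ZT_cons k
  simp only [u0, u1, ht, applyMove, topAt_zero, top_R9_z, if_true]
  unfold blowup; rw [nodeAt_zero]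
  simp [R9, z, M1, W3.add, wadd_some]
  omega
theorem stepR1 (k : ℕ) : applyMove (u1 k) (.D 1) = u2 k := by
  unfold applyMove u1 u2; simp [M1, M2, W3.sub]
theorem stepR2 (k : ℕ) : applyMove (u2 k) (.D 1) = u0 (k + 1) := by
  unfold applyMove u2 u0; simp [M2, z, ZT, W3.sub]; omega

theorem legalR0 (topj k : ℕ) : Move.P 0 ∈ legalMoves topj (u0 k) := by
  obtain ⟨t, ht, hz⟩ := ZT_cons k
  have hk := kinds_u0 k
  rw [u0, ht] at hk ⊢
  refine P0_legal' topj R9 (z k) t hk (sing2_R9_z k) ?_ ?_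
  · unfold handled relevantLight; rw [kindAt_cons_zero, kind_R9]; simp
  · unfold handled relevantLight; rw [kindAt_cons_succ, kindAt_cons_zero, kind_z]; simp
theorem legalR1 (topj k : ℕ) : Move.D 1 ∈ legalMoves topj (u1 k) :=
  D1_legal topj R9 (M1 k) _ (by rw [kind_R9]; decide) (kind_M1 k)
theorem legalR2 (topj k : ℕ) : Move.D 1 ∈ legalMoves topj (u2 k) :=
  D1_legal topj R9 (M2 k) _ (by rw [kind_R9]; decide) (kind_M2 k)

theorem mv2_period (k : ℕ) : mv2 (3 * k) = .P 0 ∧ mv2 (3 * k + 1) = .D 1 ∧ mv2 (3 * k + 2) = .D 1 := by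
  unfold mv2
  have h0 : 3 * k % 3 = 0 := by omega
  have h1 : (3 * k + 1) % 3 = 1 := by omega
  have h2 : (3 * k + 2) % 3 = 2 := by omega
  exact ⟨by simp only [h0], by simp only [h1], by simp only [h2]⟩

theorem stateR_period (k : ℕ) : playState [R9, z 0] mv2 (3 * k) = u0 k ∧ playState [R9, z 0] mv2 (3 * k + 1) = u1 k ∧
    playState [R9, z 0] mv2 (3 * k + 2) = u2 k := by
  induction k with
  | zero =>
    have e0 : playState [R9, z 0] mv2 (3 * 0) = u0 0 := rfl
    obtain ⟨m0, m1, _⟩ := mv2_period 0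
    have e1 : playState [R9, z 0] mv2 (3 * 0 + 1) = u1 0 := by
      show applyMove (playState [R9, z 0] mv2 (3 * 0)) (mv2 (3 * 0)) = u1 0; rw [m0, e0, stepR0]
    have e2 : playState [R9, z 0] mv2 (3 * 0 + 2) = u2 0 := by
      show applyMove (playState [R9, z 0] mv2 (3 * 0 + 1)) (mv2 (3 * 0 + 1)) = u2 0; rw [m1, e1, stepR1]
    exact ⟨e0, e1, e2⟩
  | succ k ih =>
    obtain ⟨_, _, e2⟩ := ih
    obtain ⟨_, _, m2⟩ := mv2_period k
    obtain ⟨m0, m1, _⟩ := mv2_period (k + 1)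
    have e0 : playState [R9, z 0] mv2 (3 * (k + 1)) = u0 (k + 1) := by
      rw [show 3 * (k + 1) = (3 * k + 2) + 1 by ring]
      show applyMove (playState [R9, z 0] mv2 (3 * k + 2)) (mv2 (3 * k + 2)) = u0 (k + 1); rw [m2, e2, stepR2]
    have e1 : playState [R9, z 0] mv2 (3 * (k + 1) + 1) = u1 (k + 1) := by
      show applyMove (playState [R9, z 0] mv2 (3 * (k + 1))) (mv2 (3 * (k + 1))) = u1 (k + 1); rw [m0, e0, stepR0]
    have e2' : playState [R9, z 0] mv2 (3 * (k + 1) + 2) = u2 (k + 1) := by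
      show applyMove (playState [R9, z 0] mv2 (3 * (k + 1) + 1)) (mv2 (3 * (k + 1) + 1)) = u2 (k + 1); rw [m1, e1, stepR1]
    exact ⟨e0, e1, e2'⟩

/-- THEOREM (hypothesis (G2) of the termination theorem is NEEDED). In mode u the chain `R — V(0,0,0)` with a DEEP residual branch
`R = (9,9,9)` (same pattern of finite grades as `V`, so (G1) holds; `ModeOK topj` for `topj ≥ 2` and the `GoodU` shape for `topj ≤ 1`)
admits the infinite legal play `P 0, D 1, D 1, P 0, D 1, D 1, …` under EVERY rule set: the residual branch is never accepted, the T-point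
stays top and is blown up for ever (`z k = V(0,3k,6k)`). In the engine this is the case `R ⊂ Sing_top`, handled OUTSIDE the S-game. -/
theorem residualDeep_infinitePlay (topj : ℕ) : IsInfinitePlay topj [R9, z 0] mv2 := by
  intro n
  obtain ⟨k, r, hr, rfl⟩ : ∃ k r, r < 3 ∧ n = 3 * k + r := ⟨n / 3, n % 3, Nat.mod_lt _ (by omega), by omega⟩
  obtain ⟨e0, e1, e2⟩ := stateR_period k
  obtain ⟨m0, m1, m2⟩ := mv2_period k
  interval_cases r
  · rw [Nat.add_zero, m0, e0]; exact legalR0 topj k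
  · rw [m1, e1]; exact legalR1 topj k
  · rw [m2, e2]; exact legalR2 topj k

theorem unbounded_legalPlays_R (topj N : ℕ) : ∃ l : List Move, isLegalPlay topj [R9, z 0] l = true ∧ N < l.length :=
  ⟨pref mv2 (N + 1), isLegalPlay_pref (N + 1) _ _ (residualDeep_infinitePlay topj), by rw [pref_length]; omega⟩

/-- COROLLARY: without (G2) the termination theorem fails — a two-curve chain `R :: [V]`, `R` residual and deep, `V` boundary and not deep,
all six grades finite (one common pattern), with an infinite legal play and legal plays of every length under every rule set. -/
theorem exists_infinitePlay_without_G2 :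
    ∃ R V : Curve, R.bd = false ∧ isDeepW R.w = true ∧ V.bd = true ∧ isDeepW V.w = false ∧
      (R.w.w0.isSome ∧ R.w.w1.isSome ∧ R.w.w2.isSome ∧ V.w.w0.isSome ∧ V.w.w1.isSome ∧ V.w.w2.isSome) ∧
      ∃ f, ∀ topj, IsInfinitePlay topj [R, V] f ∧ ∀ N, ∃ l : List Move, isLegalPlay topj [R, V] l = true ∧ N < l.length :=
  ⟨R9, z 0, rfl, by decide, rfl, by decide, by decide, mv2, fun topj => ⟨residualDeep_infinitePlay topj, unbounded_legalPlays_R topj⟩⟩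

/-! ## §I. The non-emptiness clause of (G1) is needed: with all three grades infinite the curve is «deep» for ever. -/

/-- deep-first: if curve 0 has kind deep, `D 0` is legal (every rule set) -/
theorem D0_legal (topj : ℕ) (c : Curve) (t : Chain) (hc : kindOf c = .deep) : Move.D 0 ∈ legalMoves topj (c :: t) := by
  unfold legalMoves
  have hlen : (c :: t).length = t.length + 1 := by simp
  simp only [hlen, List.range_succ_eq_map, List.filter_cons, kindAt_cons_zero, hc]
  simp

/-- the boundary curve with `w = (∞,∞,∞)` (all three class parts vanish identically): EMPTY set of finite grades -/
def cinf : Curve := ⟨⟨none, none, none⟩, 0, true⟩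
theorem kind_cinf : kindOf cinf = .deep := by decide
theorem applyD_cinf (t : Chain) : applyMove (cinf :: t) (.D 0) = cinf :: t := by
  unfold applyMove; simp [cinf, W3.sub]

/-- THEOREM (the clause «the common set of finite grades is NON-EMPTY» of (G1) is NEEDED). A curve all of whose grades are infinite is deep,
and accepting it changes nothing: `D 0` is legal for ever (every rule set, any tail). -/
theorem allInfinite_infinitePlay (topj : ℕ) (t : Chain) : IsInfinitePlay topj (cinf :: t) (fun _ => .D 0) := by
  have hs : ∀ n, playState (cinf :: t) (fun _ => .D 0) n = cinf :: t := by
    intro n; induction n with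
    | zero => rfl
    | succ n ih => show applyMove (playState (cinf :: t) (fun _ => Move.D 0) n) (.D 0) = cinf :: t; rw [ih, applyD_cinf]
  intro n; rw [hs]; exact D0_legal topj cinf t kind_cinf

theorem exists_infinitePlay_emptyPattern :
    ∃ c : Curve, c.bd = true ∧ c.w = ⟨none, none, none⟩ ∧ ∃ f, ∀ topj, IsInfinitePlay topj [c] f ∧
      ∀ N, ∃ l : List Move, isLegalPlay topj [c] l = true ∧ N < l.length :=
  ⟨cinf, rfl, rfl, fun _ => .D 0, fun topj => ⟨allInfinite_infinitePlay topj [],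
    fun N => ⟨pref (fun _ => .D 0) (N + 1), isLegalPlay_pref (N + 1) _ _ (allInfinite_infinitePlay topj []), by rw [pref_length]; omega⟩⟩⟩

end Summit.ResolutionOfSingularities.ResolutionOfSingularities.Cruxes.DescentPerfectToAll.ToricSGame.MixedLoop
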